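import Summits.BirchSwinnertonDyer.Rank1Residual.X11b.BDPValueRigidityInt
import Summits.BirchSwinnertonDyer.Rank1Residual.X11b.BDPRouteOpenInputIntFrameRecord
import HarnessLib

/-!
# Class X11b, route p2 at `p ≥ 5`: the open input H∃♭ SPLIT by ♭-V1RIG — "(2.4) for SOME BDP frame"
# (`P2.IMCDivSomeFrameOnTree`, THE open statement) + "the BDP value at `𝟙` for SOME frame"
# (`P2.BDPValueSomeFrameOnTree`, PUBLISHED on semistable pairs); H∃♭ ⟸ both (cell `b2b-bsdres`,
# sub-cell `multr1-p2`, gen 25)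

HONEST FRAMING (cell `b2b-bsdres`, run/shared/lean/b2b/bsd-rank1-residual/, verbatim in every
file): the goal of the cell is to DELETE the COMBINATION-SHAPED residual classes of the
Birch–Swinnerton-Dyer formula for ALL analytic-rank `≤ 1` elliptic curves over `ℚ` — "full BSD
formula for every rank `≤ 1` curve in class `C`" assembled STRICTLY from published theorems — so
that the rank-`≤ 1` remainder becomes exactly the CONSTRUCTION-SHAPED classes, which are TYPED
(missing-input `Prop`s), NOT attempted. This is not "finishing BSD". Sub-cell `multr1-p2` is a
RESEARCH ROUTE on class X11b (`ClassX11b W p := r_an = 1 ∧ p ≠ 2 ∧ mult(p) ∧ irr(p)`,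
`Partition/Rows.lean`); no claim beyond the stated class and loci; X11b's label does not change;
NOTHING is booked by this file.

TWO `Prop`-VALUED SHAPES (`P2.IMCDivSomeFrameOnTree` — OPEN, conjecture-tagged since gen 29
(claim-tagged in gens 25–28, see SCOPE below), nothing asserted; `P2.BDPValueSomeFrameOnTree` — PUB
shape) and THEOREMS. No named fact is introduced.

SCOPE OF THE ANNOUNCED DERIVATION (gen 29, doc + tag only; statements byte-identical; sources re-read
verbatim). `P2.IMCDivSomeFrameOnTree W p` — THE typed open statement of route p2 — is asked at CLASSICAL
Heegner data (`SatisfiesHeegnerHypothesis`: every `ℓ ∣ N_E` split in `K`). The derivation its gen-25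
docstring pointed at, the erratum's "(2.4) … By [FW21, Thm. 4.41]", carries Fouquet–Wan's hypothesis
"there exists `q ∥ N` (in particular `q ∤ p`) which is not split in `K`" (arXiv:2107.13726v3, Thm. 4.41,
third hypothesis; the full inclusion moreover wants every non-split `ℓ ∣ N` RAMIFIED in `K`, `π(f)_ℓ`
special Steinberg twisted by the unramified quadratic character), exactly as [Castella2018, p. 4] ("at
least one prime `q ∣ N` nonsplit in `K`") and [Castella2024, Thm. 3.1 (iii)] do; classical Heegner data
EXCLUDE such a `q`. So that derivation lives at route R1's ERRATUM fields and is typed there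
(`P2.IMCDivIntFrameAtErratumData`, `X11b/BDPRouteErratumData.lean`, gen 28: (T1-err) on
`R1Population`); at classical Heegner fields the published result in this direction is
[BurungaleCastellaSkinner2025, Thm. 1.2.4] (`ch(X_Gr) = (L_p^BDP)`, primes `p > 3` of GOOD ORDINARY
reduction), whose multiplicative analogue (`p ∥ N`, this shape) is in no source the cell holds, and the
only printed statement in this direction at `p ∥ N` is STEP L itself ([SkinnerZhang2014] Thm. 1.2,
PREPRINT; `indexLowerBoundAt_of_skinnerZhang_OPEN`). Hence: NO announced derivation at these data; the
shape is an instance of the Iwasawa–Greenberg main conjecture for `X_ac(E[p^∞])` ([Castella2018, §1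
(1.b)], one inclusion) and is re-badged `@[conjecture]`; every record using it was and stays CONDITIONAL
on it; nothing else changes.

## Why (gen 25, after ♭-V1RIG `constantCoeff_eq_of_isBDPLFunctionInt_of_isAnticyclotomic`)

Since gen 24 route p2's one open statement is H∃♭ `P2.IMCDivIntFrameOnTree W p`: per datum ONE
♭-frame `(Ω_K, Ω_p, Q ∈ 𝓞_{ℂ_p}⟦T⟧)` with [3.1♭] Castella's interpolation ∧ [3.2♭] the value at `𝟙`
∧ [(2.4)♭] the divisibility — ∃∧-currency: the three conjuncts are demanded of the SAME `Q`, so the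
registry reading "3.1 PUB / 3.2 PUB on semistable / (2.4) PRE" was a statement about sources, not a
split of the shape (gen 23's 29.5(4): "separating them needs frame uniqueness up to admissible
re-normalisation … not in the tree"). It IS in the tree now: ♭-V1RIG (gen 25, x11b3-p3's S27 argument
over `𝓞_{ℂ_p}⟦T⟧` with the interpolation-character supply of gen 25) says that ANY two ♭-frames of the
same `(ι, 𝔭, κ, γ, f)` — whatever their periods — have the SAME constant term, and conjunct 3.2♭
(`R1.BDPValueAtOneIntAt`) is a statement about the constant term only. Hence H∃♭ SPLITS:

* §1 shapes: **`P2.IMCDivSomeFrameOnTree W p`** — per datum ∃ ♭-frame `(Ω_K ≠ 0, ‖Ω_p‖ = 1, Q)` with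
  3.1♭ ∧ (2.4)♭ ("the erratum's IMC divisibility for SOME normalisation of the BDP `p`-adic
  `L`-function"; OPEN — THE open statement of route p2 from now on); **`P2.BDPValueSomeFrameOnTree W p`**
  — per datum ∃ ♭-frame with 3.1♭ ∧ 3.2♭ ("the BDP formula at `𝟙` for SOME normalisation"; PUB shape,
  a THEOREM on semistable pairs from `h32` via gen 23's `P2.bdpValueOnTree_of_thm32_of_semistable`).
* §2 both are WEAKER than H∃♭ (projections), and **`P2.imcDivIntFrameOnTree_of_someFrames`**: (2.4)∃♭
  ∧ value∃♭ ⟹ H∃♭ on EVERY pair (♭-V1RIG at the datum: `p ≠ 2` from X11b, `K` imaginary quadratic,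
  `κ` anticyclotomic, `γ` a topological generator — all binders of the datum).
* §3 on SEMISTABLE pairs: `P2.bdpValueSomeFrameOnTree_of_thm32_of_semistable`,
  **`P2.imcDivIntFrameOnTree_of_imcDivSomeFrame_of_semistable`** (`h32` + (2.4)∃♭ ⟹ H∃♭), and the
  Locus / semistable consequences `P2.bsdp_of_locus_of_imcDivSomeFrame_of_semistable`.

The records over the split (semistable end state from PUB + cited + (2.4)∃♭ ALONE; class record with
the value shape typed only on non-semistable pairs) are the sequel `X11b/BDPRouteOpenInputSplitRecord.lean`.

HONEST READING for the registry (no fact filed, no mark): route p2's ONE open statement is now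
`P2.IMCDivSomeFrameOnTree` — (2.4)♭ for some BDP frame (the display [Castella2018Erratum (2.4)]
transcribed to classical data; OPEN, NO announced derivation here — SCOPE above) — on every pair; the
value shape is PUB on the 753 185 semistable pairs (Cas18 Thm. 3.2) and PRE on the 1 514 163
non-semistable ones ([cas-split] Thm. 2.11 / [Castella 2024]); 3.1♭ is a theorem from Hsieh 2014 on
every pair (gen 25). CONDITIONAL; nothing booked; labels UNCHANGED; X11b stays CONSTRUCTION-SHAPED.

References: [Castella2018] §1 (1.b) (p. 3), p. 4, Thms. 3.1–3.2 (arXiv:1704.06608 p. 9);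
[Castella2018Erratum] (2.4), Thm. 1.1; [FouquetWan2021] Thm. 4.41 (arXiv:2107.13726v3 p. 44; PREPRINT);
[Castella2024] Thm. 3.1 (PREPRINT); [BurungaleCastellaSkinner2025] Thm. 1.2.4; [SkinnerZhang2014] Thm.
1.2 (PREPRINT); [CastellaHsieh2018] §3.3; [Hsieh2014] Thm. 1, p. 7.
-/

noncomputable section

open scoped Classical NumberField

open WeierstrassCurve NumberField IsDedekindDomain Field PowerSeries
open Literature.NumberTheory.EllipticCurves Literature.NumberTheory.EllipticCurves.GreenbergSelmer
open Literature.NumberTheory.EllipticCurves.ModularForms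
open Literature.NumberTheory.EllipticCurves.Rank1Residual
open Literature.NumberTheory.EllipticCurves.Rank1Residual.Typed
open Literature.NumberTheory.EllipticCurves.Wuthrich2014
open Literature.NumberTheory.EllipticCurves.Castella2018
open Literature.NumberTheory.EllipticCurves.Skinner2016
open Literature.NumberTheory.QuadraticFields.Quadratic
open Literature.NumberTheory.GaloisRepresentations Literature.NumberTheory.GaloisCohomology
open Summit.BirchSwinnertonDyer.Rank1Residual.X11b.AcSelmer
open Summit.BirchSwinnertonDyer.Rank1Residual.X11b.Halves

namespace Summit.BirchSwinnertonDyer.Rank1Residual.X11b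

/-! ### §1 The two shapes -/

section Shape

variable (W : WeierstrassCurve ℚ) [W.IsElliptic] [W.IsGloballyMinimal] (p : ℕ) [Fact p.Prime]

/-- **(2.4)∃♭ — route p2's open input, final form: the erratum's IMC DIVISIBILITY FOR SOME BDP FRAME
(OPEN shape, ∃∧-currency WITHOUT the value clause).** At every datum of `P2.IMCDivIntFrameOnTree W p`
(`(E,p)` in X11b, `p ≥ 5`, `ρ̄` onto; `K` imaginary quadratic with `d_K` odd, `p ∤ d_K`, `p ∤ #𝓞_K^×`,
every `ℓ ∣ N_E` split, `L(E^{d_K},1) ≠ 0`; parametrisation datum `Dt` of level `N_E` with `p ∤ c`;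
non-torsion Heegner point; anticyclotomic `(κ, γ)`; `ι'`, `w₀`, `P'`, `e` inducing `𝔭_{ι'}`): THERE IS
a frame `(Ω_K ≠ 0, Ω_p ∈ ℂ_p with ‖Ω_p‖ = 1, Q ∈ 𝓞_{ℂ_p}⟦T⟧)` with Castella's interpolation property
`R1.IsBDPLFunctionInt p ι' 𝔭_{ι'} κ γ f_{Dt} Ω_K Ω_p Q` [Thm. 3.1; by frame rigidity `Q` is then THE
BDP element in the normalisation `(Ω_K, Ω_p)`] ∧ `Ch_Λ(X_ac^∅(E[p^∞]))·𝓞_{ℂ_p}⟦T⟧ ⊆ (Q)` [the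
erratum's display (2.4) TRANSCRIBED to these classical data — NO announced derivation here: the
erratum's "(2.4) ⇐ [FW21, Thm. 4.41]" needs a prime `q ∥ N` NOT split in `K`; the announced derivation
is typed at erratum data as `P2.IMCDivIntFrameAtErratumData` (file docstring, SCOPE, gen 29)]. NO value
clause (gen 25: the value at `𝟙` is read off any frame by ♭-V1RIG). Weaker than H∃♭
(`P2.imcDivSomeFrameOnTree_of_imcDivIntFrame`). An instance of the Iwasawa–Greenberg main conjecture
for `X_ac(E[p^∞])` (one inclusion) at `p ∥ N` and classical Heegner fields — the multiplicative analogue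
of [BurungaleCastellaSkinner2025, Thm. 1.2.4] (good ordinary `p`), not in print; a predicate on
`(W, p)`; OPEN; NEVER a theorem in this cell; every result using it is CONDITIONAL. (Gens 25–28 badged
it as claimed-by-the-erratum — withdrawn gen 29: the erratum does not state (2.4) at these data.)
[cite: Castella2018, §1 (1.b) (arXiv:1704.06608 p. 3) and Thm. 3.1, display (3.2) (p. 9) (conjecture display and frame; shape only; nothing asserted)]
[cite: Castella2018Erratum, (2.4) (p. 4) (display transcribed; its derivation there assumes a prime of N non-split in K; nothing asserted)]
[cite: Hsieh2014, p. 7 (arXiv:1112.1580) (the receptacle `Z̄_p⟦Γ⁻⟧ ⊆ 𝓞_{ℂ_p}⟦T⟧`)] -/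
@[conjecture]
def P2.IMCDivSomeFrameOnTree : Prop :=
  ∀ (N : ℕ) [NeZero N] (K : Type) [Field K] [NumberField K]
    (Dt : ModularParametrizationData W N) (H : HeegnerDatum N (NumberField.discr K)) (ι : K →+* ℂ)
    (P : (W.baseChange K).toAffine.Point),
    ClassX11b W p → 5 ≤ p → Surj W p → W.conductorNorm ℤ = N → IsImaginaryQuadratic K →
    Odd (NumberField.discr K) → ¬ (p : ℤ) ∣ NumberField.discr K → ¬ p ∣ Units.torsionOrder K →
    SatisfiesHeegnerHypothesis N K →
    (W.quadraticTwist (NumberField.discr K : ℚ)).entireLFunction 1 ≠ 0 →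
    WeierstrassCurve.Affine.Point.map ι.toRatAlgHom P = heegnerPointComplex Dt H →
    ¬ (p : ℤ) ∣ Dt.c → ¬ IsOfFinAddOrder P →
    ∀ (κ : ZpExtension K p), κ.IsAnticyclotomic →
      ∀ (γ : Field.absoluteGaloisGroup K) [Fact (κ.IsTopGenerator γ)]
        (ι' : PadicAlgCl p ≃+* ℂ) (w₀ : InfinitePlace K) (P' : (W.baseChange K).toAffine.Point),
        WeierstrassCurve.Affine.Point.map w₀.embedding.toRatAlgHom P' = heegnerPointComplex Dt H →
        ∀ (e : K →+* ℚ_[p]),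
          (∀ k : 𝓞 K, k ∈ (primeOfEmbeddingDatum p ι' w₀.embedding).asIdeal ↔ ‖e (k : K)‖ < 1) →
          ∃ (ΩK : ℂ) (Ωp : ℂ_[p]) (Q : PowerSeries 𝓞_ℂ_[p]), ΩK ≠ 0 ∧ ‖Ωp‖ = 1 ∧
            R1.IsBDPLFunctionInt p ι' (primeOfEmbeddingDatum p ι' w₀.embedding) κ γ Dt.f ΩK Ωp Q ∧
            (XAc.charIdeal (W.baseChange K) p κ (primeOfEmbeddingDatum p ι' w₀.embedding) ∅ γ).map
              (PowerSeries.map (R1.toCpInt p)) ≤ Ideal.span {Q}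

/-- **value∃♭ — the BDP formula at `𝟙` FOR SOME BDP FRAME (PUB shape, ∃∧-currency).** At every datum
(same binders): THERE IS a frame `(Ω_K ≠ 0, ‖Ω_p‖ = 1, Q ∈ 𝓞_{ℂ_p}⟦T⟧)` with Castella's interpolation
property [Thm. 3.1] ∧ `Q(𝟙) = u·((1 − a_p(E) p⁻¹)·log_{ω_E} P')²`, `‖u‖ = 1` [Thm. 3.2;
`R1.BDPValueAtOneIntAt`]. PUBLISHED on semistable pairs (Cas18 Thms. 3.1–3.2, via `h32`:
`P2.bdpValueSomeFrameOnTree_of_thm32_of_semistable`); printed for non-semistable split `p ≥ 5` in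
[cas-split] Thm. 2.11 (continuous-function currency) and in general in [Castella 2024] (PREPRINT).
Weaker than H∃♭ and than gen 23's `P2.BDPValueOnTree` (`R₀` currency). A predicate; nothing asserted.
[cite: Castella2018, Thm. 3.1 and Thm. 3.2 (arXiv:1704.06608 p. 9) (shape only; nothing asserted)] -/
def P2.BDPValueSomeFrameOnTree : Prop :=
  ∀ (N : ℕ) [NeZero N] (K : Type) [Field K] [NumberField K]
    (Dt : ModularParametrizationData W N) (H : HeegnerDatum N (NumberField.discr K)) (ι : K →+* ℂ)
    (P : (W.baseChange K).toAffine.Point),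
    ClassX11b W p → 5 ≤ p → Surj W p → W.conductorNorm ℤ = N → IsImaginaryQuadratic K →
    Odd (NumberField.discr K) → ¬ (p : ℤ) ∣ NumberField.discr K → ¬ p ∣ Units.torsionOrder K →
    SatisfiesHeegnerHypothesis N K →
    (W.quadraticTwist (NumberField.discr K : ℚ)).entireLFunction 1 ≠ 0 →
    WeierstrassCurve.Affine.Point.map ι.toRatAlgHom P = heegnerPointComplex Dt H →
    ¬ (p : ℤ) ∣ Dt.c → ¬ IsOfFinAddOrder P →
    ∀ (κ : ZpExtension K p), κ.IsAnticyclotomic →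
      ∀ (γ : Field.absoluteGaloisGroup K) [Fact (κ.IsTopGenerator γ)]
        (ι' : PadicAlgCl p ≃+* ℂ) (w₀ : InfinitePlace K) (P' : (W.baseChange K).toAffine.Point),
        WeierstrassCurve.Affine.Point.map w₀.embedding.toRatAlgHom P' = heegnerPointComplex Dt H →
        ∀ (e : K →+* ℚ_[p]),
          (∀ k : 𝓞 K, k ∈ (primeOfEmbeddingDatum p ι' w₀.embedding).asIdeal ↔ ‖e (k : K)‖ < 1) →
          ∃ (ΩK : ℂ) (Ωp : ℂ_[p]) (Q : PowerSeries 𝓞_ℂ_[p]), ΩK ≠ 0 ∧ ‖Ωp‖ = 1 ∧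
            R1.IsBDPLFunctionInt p ι' (primeOfEmbeddingDatum p ι' w₀.embedding) κ γ Dt.f ΩK Ωp Q ∧
            R1.BDPValueAtOneIntAt W p e P' Q (W.LFunction p)

end Shape

/-! ### §2 Both shapes are weaker than H∃♭; together they give H∃♭ back (♭-V1RIG) -/

section Split

variable {W : WeierstrassCurve ℚ} [W.IsElliptic] [W.IsGloballyMinimal] {p : ℕ} [Fact p.Prime]

/-- H∃♭ ⟹ (2.4)∃♭ (forget the value clause). [claim: Castella2018Erratum, status: under-review] -/
theorem P2.imcDivSomeFrameOnTree_of_imcDivIntFrame (hF : P2.IMCDivIntFrameOnTree W p) :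
    P2.IMCDivSomeFrameOnTree W p := by
  intro N _ K _ _ Dt H ιK P hX h5 hs hN hK hodd hpd hμ hHN hLt hP hc hPinf κ hκ γ _ ι' w₀ P' hP' e he
  obtain ⟨ΩK, Ωp, Q, hΩK, hΩp, hQ, -, hdiv⟩ :=
    hF N K Dt H ιK P hX h5 hs hN hK hodd hpd hμ hHN hLt hP hc hPinf κ hκ γ ι' w₀ P' hP' e he
  exact ⟨ΩK, Ωp, Q, hΩK, hΩp, hQ, hdiv⟩

/-- H∃♭ ⟹ value∃♭ (forget the divisibility). [cite: Castella2018, Thms. 3.1–3.2 (arXiv:1704.06608 p. 9)] -/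
theorem P2.bdpValueSomeFrameOnTree_of_imcDivIntFrame (hF : P2.IMCDivIntFrameOnTree W p) :
    P2.BDPValueSomeFrameOnTree W p := by
  intro N _ K _ _ Dt H ιK P hX h5 hs hN hK hodd hpd hμ hHN hLt hP hc hPinf κ hκ γ _ ι' w₀ P' hP' e he
  obtain ⟨ΩK, Ωp, Q, hΩK, hΩp, hQ, hval, -⟩ :=
    hF N K Dt H ιK P hX h5 hs hN hK hodd hpd hμ hHN hLt hP hc hPinf κ hκ γ ι' w₀ P' hP' e he
  exact ⟨ΩK, Ωp, Q, hΩK, hΩp, hQ, hval⟩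

/-- Gen 23's `R₀`-currency value shape ⟹ value∃♭ (read the `R₀`-frame in `𝓞_{ℂ_p}⟦T⟧`).
[cite: Castella2018, Thms. 3.1–3.2 (arXiv:1704.06608 p. 9)] -/
theorem P2.bdpValueSomeFrameOnTree_of_bdpValueOnTree (h2 : P2.BDPValueOnTree W p) :
    P2.BDPValueSomeFrameOnTree W p := by
  intro N _ K _ _ Dt H ιK P hX h5 hs hN hK hodd hpd hμ hHN hLt hP hc hPinf κ hκ γ _ ι' w₀ P' hP' e he
  obtain ⟨ΩK, Ωp, L, hΩK, hL, hval⟩ :=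
    h2 N K Dt H ιK P hX h5 hs hN hK hodd hpd hμ hHN hLt hP hc hPinf κ hκ γ ι' w₀ P' hP' e he
  exact ⟨ΩK, ((Ωp : unrIntegers p) : ℂ_[p]), PowerSeries.map (R1.unrToCpInt p) L, hΩK,
    norm_coe_units_unrIntegers p Ωp, R1.isBDPLFunctionInt_map hL, R1.bdpValueAtOneIntAt_map hval⟩

/-- **The value clause transfers between ♭-frames** (♭-V1RIG): at an anticyclotomic datum (odd `p`,
`K` imaginary quadratic, `κ` anticyclotomic with topological generator `γ`), if two ♭-frames
`(Ω_K, Ω_p, Q)`, `(Ω_K', Ω_p', Q')` of the same `(ι, 𝔭, κ, γ, f)` have non-zero periods and `Q'`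
satisfies `R1.BDPValueAtOneIntAt W p e P' Q' a`, then so does `Q` (same constant term,
`constantCoeff_eq_of_isBDPLFunctionInt_of_isAnticyclotomic`). [cite: Castella2018, Thms. 3.1–3.2 (arXiv:1704.06608 p. 9)] -/
theorem R1.bdpValueAtOneIntAt_of_frames (hp2 : p ≠ 2) {K : Type} [Field K] [NumberField K] {N : ℕ}
    {ι' : PadicAlgCl p ≃+* ℂ} {𝔭 : HeightOneSpectrum (𝓞 K)} {κ : ZpExtension K p}
    {γ : Field.absoluteGaloisGroup K} {f : CuspForm (CongruenceSubgroup.Gamma0 N) 2}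
    {ΩK ΩK' : ℂ} {Ωp Ωp' : ℂ_[p]} {Q Q' : PowerSeries 𝓞_ℂ_[p]} (hK : IsImaginaryQuadratic K)
    (hκ : κ.IsAnticyclotomic) (hγ : κ.IsTopGenerator γ) (hΩK : ΩK ≠ 0) (hΩK' : ΩK' ≠ 0)
    (hΩp : Ωp ≠ 0) (hΩp' : Ωp' ≠ 0) (hQ : R1.IsBDPLFunctionInt p ι' 𝔭 κ γ f ΩK Ωp Q)
    (hQ' : R1.IsBDPLFunctionInt p ι' 𝔭 κ γ f ΩK' Ωp' Q') {e : K →+* ℚ_[p]}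
    {P' : (W.baseChange K).toAffine.Point} {a : ℤ} (hval : R1.BDPValueAtOneIntAt W p e P' Q' a) :
    R1.BDPValueAtOneIntAt W p e P' Q a := by
  obtain ⟨u, hu, hv⟩ := hval
  refine ⟨u, hu, ?_⟩
  have hcc : PowerSeries.constantCoeff Q' = PowerSeries.constantCoeff Q :=
    constantCoeff_eq_of_isBDPLFunctionInt_of_isAnticyclotomic hp2 hK hκ hγ hΩK hΩK' hΩp hΩp' hQ hQ'
  have heq := R1.intSeries_eq_constantCoeff_of_hasValueAt_zero p hv
  rw [hcc] at heq
  rw [heq]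
  exact R1.intSeries_hasValueAt_zero p Q

/-- **THE SPLIT: (2.4)∃♭ ∧ value∃♭ ⟹ H∃♭, on EVERY pair.** At a datum take the frame `(Ω_K, Ω_p, Q)` of
(2.4)∃♭ and the frame `(Ω_K', Ω_p', Q')` of value∃♭; by ♭-V1RIG (`p ≠ 2` from X11b, `K` imaginary
quadratic, `κ` anticyclotomic, `γ` a topological generator — binders of the datum; `‖Ω_p‖ = ‖Ω_p'‖ = 1`
so both are non-zero) `[T⁰]Q = [T⁰]Q'`, and the value clause — a statement about the constant term —
passes from `Q'` to `Q`. So route p2's shape H∃♭ is EQUIVALENT to the conjunction of the two weaker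
shapes; what is OPEN in it is exactly (2.4)∃♭. CONDITIONAL on both shapes; nothing booked.
[cite: Castella2018, Thms. 3.1–3.2 (arXiv:1704.06608 p. 9)] [cite: Castella2018Erratum, (2.4) (p. 4)] -/
theorem P2.imcDivIntFrameOnTree_of_someFrames (hD : P2.IMCDivSomeFrameOnTree W p)
    (hV : P2.BDPValueSomeFrameOnTree W p) : P2.IMCDivIntFrameOnTree W p := by
  intro N _ K _ _ Dt H ιK P hX h5 hs hN hK hodd hpd hμ hHN hLt hP hc hPinf κ hκ γ hγ ι' w₀ P' hP' e he
  obtain ⟨ΩK, Ωp, Q, hΩK, hΩp, hQ, hdiv⟩ :=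
    hD N K Dt H ιK P hX h5 hs hN hK hodd hpd hμ hHN hLt hP hc hPinf κ hκ γ ι' w₀ P' hP' e he
  obtain ⟨ΩK', Ωp', Q', hΩK', hΩp', hQ', hval⟩ :=
    hV N K Dt H ιK P hX h5 hs hN hK hodd hpd hμ hHN hLt hP hc hPinf κ hκ γ ι' w₀ P' hP' e he
  have hΩp0 : Ωp ≠ 0 := fun h ↦ by rw [h, norm_zero] at hΩp; exact zero_ne_one hΩp
  have hΩp0' : Ωp' ≠ 0 := fun h ↦ by rw [h, norm_zero] at hΩp'; exact zero_ne_one hΩp'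
  exact ⟨ΩK, Ωp, Q, hΩK, hΩp, hQ,
    R1.bdpValueAtOneIntAt_of_frames hX.2.1 hK hκ hγ.out hΩK hΩK' hΩp0 hΩp0' hQ hQ' hval, hdiv⟩

/-- **H∃♭ ⟺ (2.4)∃♭ ∧ value∃♭.** [cite: Castella2018, Thms. 3.1–3.2 (arXiv:1704.06608 p. 9)]
[cite: Castella2018Erratum, (2.4) (p. 4)] -/
theorem P2.imcDivIntFrameOnTree_iff_someFrames :
    P2.IMCDivIntFrameOnTree W p ↔ P2.IMCDivSomeFrameOnTree W p ∧ P2.BDPValueSomeFrameOnTree W p :=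
  ⟨fun h ↦ ⟨P2.imcDivSomeFrameOnTree_of_imcDivIntFrame h, P2.bdpValueSomeFrameOnTree_of_imcDivIntFrame h⟩,
    fun h ↦ P2.imcDivIntFrameOnTree_of_someFrames h.1 h.2⟩

end Split

/-! ### §3 On SEMISTABLE pairs the value shape is PUBLISHED: H∃♭ ⟸ `h32` + (2.4)∃♭ -/

section Semistable

variable {W : WeierstrassCurve ℚ} [W.IsElliptic] [W.IsGloballyMinimal] {p : ℕ} [Fact p.Prime]

/-- **value∃♭ on a SEMISTABLE pair from the published fact** `h32` (Castella 2018 Thms. 3.1–3.2 at a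
classical Heegner field, multr1-p1's instantiation; gen 23's `P2.bdpValueOnTree_of_thm32_of_semistable`
read in `𝓞_{ℂ_p}⟦T⟧`). [cite: Castella2018, Thm. 3.1, display (3.2) and Thm. 3.2 (arXiv:1704.06608 p. 9)] -/
theorem P2.bdpValueSomeFrameOnTree_of_thm32_of_semistable
    (h32 : thm32_exists_isBDPLFunction_valueAtOne) (hss : Semistable W) :
    P2.BDPValueSomeFrameOnTree W p :=
  P2.bdpValueSomeFrameOnTree_of_bdpValueOnTree (P2.bdpValueOnTree_of_thm32_of_semistable h32 hss)

/-- **On a SEMISTABLE pair: `h32` + (2.4)∃♭ ⟹ H∃♭** — the open content of route p2's input on the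
753 185 semistable X11b pairs is EXACTLY "(2.4) for some BDP frame". CONDITIONAL on `h32` (published)
and (2.4)∃♭ (open). [cite: Castella2018, Thms. 3.1–3.2 (arXiv:1704.06608 p. 9)]
[cite: Castella2018Erratum, (2.4) (p. 4)] -/
theorem P2.imcDivIntFrameOnTree_of_imcDivSomeFrame_of_semistable
    (h32 : thm32_exists_isBDPLFunction_valueAtOne) (hss : Semistable W)
    (hD : P2.IMCDivSomeFrameOnTree W p) : P2.IMCDivIntFrameOnTree W p :=
  P2.imcDivIntFrameOnTree_of_someFrames hD (P2.bdpValueSomeFrameOnTree_of_thm32_of_semistable h32 hss)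

/-- **A1 ∩ semistable — ANY semistable Locus pair (723 144 ‖ 28 657): `BSD(E,p)` from published +
cited facts (incl. `h32`) and (2.4)∃♭ AT THE PAIR — nothing per pair, no value clause, no `R₀`.**
Gen 24's `P2.bsdp_of_locus_of_imcDivIntFrame` with H∃♭ from the split. CONDITIONAL on (2.4)∃♭; nothing
booked. [cite: Castella2018Erratum, (2.4), Thm. 1.1 (pp. 1, 4)] [cite: Castella2018, Thms. 3.1–3.2, §5]
[cite: Skinner2016PacificMC, Thm. C (§1)] [cite: McCallumLMS1991, §1 Theorem (Kolyvagin), p. 296] -/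
theorem P2.bsdp_of_locus_of_imcDivSomeFrame_of_semistable
    (hGZ : ∀ (N : ℕ) [NeZero N] (W : WeierstrassCurve ℚ) (K : Type) [Field K] [NumberField K],
      gross_zagier N W K)
    (hKo : ∀ (N : ℕ) [NeZero N] (W : WeierstrassCurve ℚ) (K : Type) [Field K] [NumberField K],
      kolyvagin N W K)
    (hB : ∀ (N : ℕ) [NeZero N] (W : WeierstrassCurve ℚ) (K : Type) [Field K] [NumberField K],
      Kolyvagin1990_padicValNat_card_sha_le N W K)
    (hSk : Skinner2016.thmC_padicValRat_bsd_rank_zero) (hWu : sha_dvd_analyticSha)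
    (hGZK : rank_eq_analyticRank_of_analyticRank_le_one) (hnf : exists_isNewformOf)
    (hHL : HoffsteinLuo1997_exists_twist_L_one_ne_zero) (hMaz : mazur_not_dvd_maninConstant_of_odd)
    (hPT : ∀ (K : Type) [Field K] [NumberField K], poitouTate_sum_localTatePairing_eq_zero K)
    (hEP : ∀ (K : Type) [Field K] [NumberField K] (v : HeightOneSpectrum (𝓞 K)),
      localEulerPoincareCharacteristic (v.adicCompletion K))
    (h32 : thm32_exists_isBDPLFunction_valueAtOne) (hss : Semistable W)
    (hD : P2.IMCDivSomeFrameOnTree W p)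
    (hX : ClassX11b W p) (hp5 : 5 ≤ p) (hram : Ram W p) (htam : ¬ p ∣ W.tamagawaProduct) :
    BSDp W p :=
  P2.bsdp_of_locus_of_imcDivIntFrame hGZ hKo hB hSk hWu hGZK hnf hHL hMaz hPT hEP
    (P2.imcDivIntFrameOnTree_of_imcDivSomeFrame_of_semistable h32 hss hD) hX hp5 hram htam

end Semistable

end Summit.BirchSwinnertonDyer.Rank1Residual.X11b

end
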